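import Literature.Analysis.FluidPDE.OseenSlabDuhamel
import HarnessLib

/-!
# Sup-norm perturbation theory of the Oseen integral equation on a time slab, III:
  the weighted contraction, `(1 + L_a[U])⁻¹`, and the solution operator with its strict derivative

Analysis/FluidPDE file (definitions `slabWeight`, `slabWeightCLM`, `slabWeightEquiv`,
`slabLinConj`; everything else proved).  Conjugating the linearised operator `L = L_a[U]` by the
time weight `Θ = e^{-λ(t-a)}` with `λ = linRate E ‖U‖ = (12 C₀ ‖U‖)² + 1` gives
`‖Θ L Θ⁻¹‖ ≤ 1/2` (`setIntegral_abelKernel_mul_exp_le`, `linRate_contraction` — the weighted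
sup-norm trick of Coiculescu–Palasek App. B / KNSS §4), hence `1 + L` has a bounded two-sided
inverse `J` (Neumann series, Mathlib `Units.oneSub`, conjugated back).  With
`A = J ∘ e^{(·-a)Δ}` and `Q = B_a` the abstract quadratic solution-map theorem
(`Literature.Analysis.Calculus.exists_solutionMap_hasStrictFDerivAt_invariant`) yields the
solution operator `sol` of the perturbation equation `w + L w + B_a(w, w) = e^{(·-a)Δ} g` for
small data, unique in a ball, Lipschitz, with `HasStrictFDerivAt sol A 0` (the derivative is the
solution operator of the LINEARISED equation) and the invariance of closed submodules containing
the range of `L` (`exists_slabSolutionMap`).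

## References

* G. Koch, N. Nadirashvili, G. Seregin, V. Šverák, *Liouville theorems for the Navier–Stokes
  equations and applications*, Acta Math. 203 (2009) = arXiv:0709.3599, §4 (4.3)–(4.4)
  (`u = U + B(u,u)` solved on `L^∞` by a fixed point; `‖B(u,v)‖ ≤ C√T‖u‖‖v‖`).
  [KochNadirashviliSereginSverak2009]
* M. P. Coiculescu, S. Palasek, Invent. Math. 244 (2025) = arXiv:2503.14699, App. B, Prop. B.1
  (the linearised problem in the exponentially weighted sup norm). [CoiculescuPalasek2025]
* D. Henry, *Geometric Theory of Semilinear Parabolic Equations*, LNM 840 (1981), §3.3–3.4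
  (differentiable dependence on the data). [Henry1981]
-/

noncomputable section

open MeasureTheory Set Function Filter
open _root_.Topology
open scoped BoundedContinuousFunction

namespace Literature.Analysis.FluidPDE

variable {E : Type*} [NormedAddCommGroup E] [InnerProductSpace ℝ E] [FiniteDimensional ℝ E]
  [MeasurableSpace E] [BorelSpace E]

/-! ### The exponential time weight and the contraction of the linearised operator -/

section Weight

variable {a b : ℝ} (hab : a ≤ b)

/-- The scalar weight `(t, x) ↦ e^{κ(t-a)}` is continuous on `ℝ × X`. [folklore] -/
theorem continuous_expWeight {X : Type*} [TopologicalSpace X] (κ a : ℝ) :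
    Continuous fun p : ℝ × X => Real.exp (κ * (p.1 - a)) :=
  Real.continuous_exp.comp (continuous_const.mul (continuous_fst.sub continuous_const))

/-- Multiplication of a slab field by the scalar time weight `e^{κ (t - a)}` (any real `κ`):
the field `(t, x) ↦ e^{κ(t-a)} W(t, x)` on the slab. [folklore] -/
def slabWeight (κ : ℝ) (W : (Icc a b) × E →ᵇ E) : (Icc a b) × E →ᵇ E :=
  slabMk (fun t x => Real.exp (κ * (t - a)) • slabPhys hab W t x)
    ((continuous_expWeight κ a).continuousOn.smul (continuousOn_uncurry_slabPhys hab W))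
    (max 1 (Real.exp (κ * (b - a))) * ‖W‖)
    (fun t ht x => by
      rw [norm_smul, Real.norm_of_nonneg (Real.exp_pos _).le]
      refine mul_le_mul ?_ (norm_slabPhys_le hab W t x) (norm_nonneg _) (by positivity)
      rcases le_or_gt 0 κ with hκ | hκ
      · exact (Real.exp_le_exp.2 (by nlinarith [ht.1, ht.2])).trans (le_max_right _ _)
      · refine le_trans ?_ (le_max_left _ _)
        rw [Real.exp_le_one_iff]; nlinarith [ht.1])

omit [FiniteDimensional ℝ E] [MeasurableSpace E] [BorelSpace E] in
/-- Values of the weighted field. [folklore] -/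
@[simp]
theorem slabWeight_apply (κ : ℝ) (W : (Icc a b) × E →ᵇ E) (p : (Icc a b) × E) :
    slabWeight hab κ W p = Real.exp (κ * (p.1 - a)) • W p := by
  simp [slabWeight, slabPhys_apply_coe hab W p]

omit [FiniteDimensional ℝ E] [MeasurableSpace E] [BorelSpace E] in
/-- Norm bound of the weighted field: `‖e^{κ(·-a)} W‖ ≤ max 1 e^{κ(b-a)} ‖W‖`. [folklore] -/
theorem norm_slabWeight_le (κ : ℝ) (W : (Icc a b) × E →ᵇ E) :
    ‖slabWeight hab κ W‖ ≤ max 1 (Real.exp (κ * (b - a))) * ‖W‖ :=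
  norm_slabMk_le _ _ (by positivity) _

/-- The weight multiplication as a bounded linear operator. [folklore] -/
def slabWeightCLM (κ : ℝ) : ((Icc a b) × E →ᵇ E) →L[ℝ] ((Icc a b) × E →ᵇ E) :=
  LinearMap.mkContinuous
    { toFun := slabWeight hab κ
      map_add' := fun W W' => by ext p; simp [smul_add]
      map_smul' := fun r W => by ext p; simp [smul_comm r] }
    (max 1 (Real.exp (κ * (b - a)))) (fun W => norm_slabWeight_le hab κ W)

omit [FiniteDimensional ℝ E] [MeasurableSpace E] [BorelSpace E] in
/-- Values of the weight operator. [folklore] -/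
@[simp]
theorem slabWeightCLM_apply (κ : ℝ) (W : (Icc a b) × E →ᵇ E) :
    slabWeightCLM hab κ W = slabWeight hab κ W := rfl

omit [FiniteDimensional ℝ E] [MeasurableSpace E] [BorelSpace E] in
/-- Opposite weights cancel: `e^{-κ(·-a)} e^{κ(·-a)} W = W`. [folklore] -/
theorem slabWeight_neg_slabWeight (κ : ℝ) (W : (Icc a b) × E →ᵇ E) :
    slabWeight hab (-κ) (slabWeight hab κ W) = W := by
  ext p
  simp only [slabWeight_apply, smul_smul, neg_mul, Real.exp_neg]
  rw [inv_mul_cancel₀ (Real.exp_pos _).ne', one_smul]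

/-- **The weight isomorphism** `Θ_κ W = e^{-κ(·-a)} W` with inverse `e^{κ(·-a)} W`. [folklore] -/
def slabWeightEquiv (κ : ℝ) : ((Icc a b) × E →ᵇ E) ≃L[ℝ] ((Icc a b) × E →ᵇ E) :=
  ContinuousLinearEquiv.equivOfInverse (slabWeightCLM hab (-κ)) (slabWeightCLM hab κ)
    (fun W => by simpa using slabWeight_neg_slabWeight hab (-κ) W)
    (fun W => slabWeight_neg_slabWeight hab κ W)

omit [FiniteDimensional ℝ E] [MeasurableSpace E] [BorelSpace E] in
/-- Values of the weight isomorphism. [folklore] -/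
@[simp]
theorem slabWeightEquiv_apply (κ : ℝ) (W : (Icc a b) × E →ᵇ E) (p : (Icc a b) × E) :
    slabWeightEquiv hab κ W p = Real.exp (-(κ * (p.1 - a))) • W p := by
  simp [slabWeightEquiv, neg_mul]

omit [FiniteDimensional ℝ E] [MeasurableSpace E] [BorelSpace E] in
/-- Values of the inverse weight isomorphism. [folklore] -/
@[simp]
theorem slabWeightEquiv_symm_apply (κ : ℝ) (W : (Icc a b) × E →ᵇ E) (p : (Icc a b) × E) :
    (slabWeightEquiv hab κ).symm W p = Real.exp (κ * (p.1 - a)) • W p := by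
  simp [slabWeightEquiv]

/-- **The weighted contraction estimate** (Coiculescu–Palasek 2025, App. B; KNSS 2009 §4): with
`λ = linRate E ‖U‖ = (12 C₀ ‖U‖)² + 1`, the linearised operator conjugated by the weight
`e^{-λ(t-a)}` has norm `≤ 1/2` on slab fields: for `V = e^{λ(·-a)} W` one has
`‖L_a[U](V)(t)‖ ≤ 2C₀‖U‖‖W‖ ∫_a^t (t-τ)^{-1/2} e^{λ(τ-a)} dτ ≤ 2C₀‖U‖ · 3λ^{-1/2} e^{λ(t-a)} ‖W‖`
(`setIntegral_abelKernel_mul_exp_le`, `linRate_contraction`). [cite: KochNadirashviliSereginSverak2009, §4 (4.3)–(4.4)] -/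
theorem norm_weight_slabLin_weight_le (U W : (Icc a b) × E →ᵇ E) :
    ‖slabWeightEquiv hab (linRate E ‖U‖)
        (slabLin hab U ((slabWeightEquiv hab (linRate E ‖U‖)).symm W))‖ ≤ (1 / 2) * ‖W‖ := by
  set lam : ℝ := linRate E ‖U‖ with hlam
  have hlam0 : 0 < lam := linRate_pos (E := E) ‖U‖
  set V := (slabWeightEquiv hab lam).symm W with hV
  refine BoundedContinuousFunction.norm_le (by positivity) |>.2 fun p => ?_
  obtain ⟨⟨t, ht⟩, x⟩ := p
  rw [slabWeightEquiv_apply, slabLin_apply, norm_smul, Real.norm_of_nonneg (Real.exp_pos _).le]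
  -- envelope of the physical field of `V = e^{λ(·-a)} W`
  have hVenv : ∀ τ ∈ Ioo a t, ∀ y, ‖slabPhys hab V τ y‖ ≤ Real.exp (lam * (τ - a)) * ‖W‖ := by
    intro τ hτ y
    have hτ' : τ ∈ Icc a b := ⟨hτ.1.le, hτ.2.le.trans ht.2⟩
    rw [slabPhys_of_mem hab V hτ', hV, slabWeightEquiv_symm_apply, norm_smul,
      Real.norm_of_nonneg (Real.exp_pos _).le]
    exact mul_le_mul_of_nonneg_left (W.norm_coe_le_norm _) (Real.exp_pos _).le
  have hUenv : ∀ τ ∈ Ioo a t, ∀ y, ‖slabPhys hab U τ y‖ ≤ ‖U‖ := slabPhys_bound hab U t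
  have hint : IntegrableOn (fun τ => (t - τ) ^ (-(1 / 2 : ℝ)) *
      (‖U‖ * (Real.exp (lam * (τ - a)) * ‖W‖))) (Ioo a t) := by
    have h1 : IntegrableOn (fun τ : ℝ => (t - τ) ^ (-(1 / 2 : ℝ))) (Ioo a t) :=
      integrableOn_sub_rpow_Ioo (by norm_num)
    have h2 : IntegrableOn (fun τ : ℝ => (t - τ) ^ (-(1 / 2 : ℝ)) * Real.exp (lam * (τ - a)))
        (Ioo a t) := by
      refine (h1.mul_const (Real.exp (lam * (t - a)))).mono' ?_ ?_
      · exact ((measurable_id.const_sub t).pow_const _).mul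
          ((measurable_const.mul (measurable_id.sub_const a)).exp) |>.aestronglyMeasurable
      · refine (ae_restrict_mem measurableSet_Ioo).mono fun τ hτ => ?_
        rw [Real.norm_of_nonneg (by
          have : 0 ≤ (t - τ) ^ (-(1 / 2 : ℝ)) := Real.rpow_nonneg (sub_nonneg.2 hτ.2.le) _
          positivity)]
        have : 0 ≤ (t - τ) ^ (-(1 / 2 : ℝ)) := Real.rpow_nonneg (sub_nonneg.2 hτ.2.le) _
        gcongr
        exact hτ.2.le
    have h3 := h2.mul_const (‖U‖ * ‖W‖)
    refine h3.congr (Eventually.of_forall fun τ => ?_)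
    simp only; ring
  have hL := norm_linOseen_le (t₀ := a) (v := slabPhys hab U) hUenv hVenv hint x
  have hI : ∫ τ in Ioo a t, (t - τ) ^ (-(1 / 2 : ℝ)) * (‖U‖ * (Real.exp (lam * (τ - a)) * ‖W‖)) ≤
      3 * lam ^ (-(1 / 2 : ℝ)) * Real.exp (lam * (t - a)) * (‖U‖ * ‖W‖) := by
    have heq : (fun τ => (t - τ) ^ (-(1 / 2 : ℝ)) * (‖U‖ * (Real.exp (lam * (τ - a)) * ‖W‖))) =
        fun τ => ((t - τ) ^ (-(1 / 2 : ℝ)) * Real.exp (lam * (τ - a))) * (‖U‖ * ‖W‖) := by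
      funext τ; ring
    rw [heq, integral_mul_const]
    exact mul_le_mul_of_nonneg_right (setIntegral_abelKernel_mul_exp_le hlam0 ht.1) (by positivity)
  have hC := (oseenSliceConst_pos (E := E)).le
  have hrate := linRate_contraction (E := E) ‖U‖
  rw [abs_of_nonneg (norm_nonneg U)] at hrate
  calc Real.exp (-(lam * (t - a))) * ‖linOseen a (slabPhys hab U) (slabPhys hab V) t x‖
      ≤ Real.exp (-(lam * (t - a))) * (2 * oseenSliceConst E *
          (3 * lam ^ (-(1 / 2 : ℝ)) * Real.exp (lam * (t - a)) * (‖U‖ * ‖W‖))) := by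
        gcongr
        exact hL.trans (by gcongr)
    _ = (2 * oseenSliceConst E * ‖U‖ * (3 * lam ^ (-(1 / 2 : ℝ)))) * ‖W‖ *
          (Real.exp (-(lam * (t - a))) * Real.exp (lam * (t - a))) := by ring
    _ = (2 * oseenSliceConst E * ‖U‖ * (3 * lam ^ (-(1 / 2 : ℝ)))) * ‖W‖ := by
        rw [← Real.exp_add, neg_add_cancel, Real.exp_zero, mul_one]
    _ ≤ (1 / 2) * ‖W‖ := by gcongr

/-- **The conjugated linearised operator** `Θ L_a[U] Θ⁻¹`, `Θ = e^{-λ(·-a)}`,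
`λ = linRate E ‖U‖`. [folklore] -/
def slabLinConj (U : (Icc a b) × E →ᵇ E) : ((Icc a b) × E →ᵇ E) →L[ℝ] ((Icc a b) × E →ᵇ E) :=
  (slabWeightEquiv hab (linRate E ‖U‖)).toContinuousLinearMap ∘L slabLin hab U ∘L
    (slabWeightEquiv hab (linRate E ‖U‖)).symm.toContinuousLinearMap

/-- Values of the conjugated operator. [folklore] -/
theorem slabLinConj_apply (U W : (Icc a b) × E →ᵇ E) :
    slabLinConj hab U W = slabWeightEquiv hab (linRate E ‖U‖)
      (slabLin hab U ((slabWeightEquiv hab (linRate E ‖U‖)).symm W)) := rfl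

/-- The conjugated linearised operator has operator norm `≤ 1/2`. [folklore] -/
theorem opNorm_slabLinConj_le (U : (Icc a b) × E →ᵇ E) : ‖slabLinConj hab U‖ ≤ 1 / 2 :=
  ContinuousLinearMap.opNorm_le_bound _ (by norm_num) fun W => by
    rw [slabLinConj_apply]
    exact norm_weight_slabLin_weight_le hab U W

end Weight

/-! ### Invertibility of `1 + L_a[U]` and the solution operator of the perturbation equation -/

section Solve

variable {a b : ℝ} (hab : a ≤ b)

/-- **`1 + L_a[U]` is invertible** on slab fields: the conjugate `1 + Θ L Θ⁻¹` is within `1/2` of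
the identity (Neumann series, Mathlib `Units.oneSub`), and conjugating back gives a two-sided
bounded inverse `J`. This replaces the Volterra/Picard solution of the linearised problem
(Coiculescu–Palasek 2025, App. B, Prop. B.1). [cite: CoiculescuPalasek2025, App. B, Prop. B.1] -/
theorem exists_inverse_one_add_slabLin (U : (Icc a b) × E →ᵇ E) :
    ∃ J : ((Icc a b) × E →ᵇ E) →L[ℝ] ((Icc a b) × E →ᵇ E),
      (∀ W, J (W + slabLin hab U W) = W) ∧ (∀ W, J W + slabLin hab U (J W) = W) := by
  set Θ : ((Icc a b) × E →ᵇ E) ≃L[ℝ] ((Icc a b) × E →ᵇ E) :=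
    slabWeightEquiv hab (linRate E ‖U‖) with hΘ
  set L' := slabLinConj hab U with hL'
  have hnorm : ‖-L'‖ < 1 := by
    rw [ContinuousLinearMap.opNorm_neg]
    exact (opNorm_slabLinConj_le hab U).trans_lt (by norm_num)
  set u := Units.oneSub (-L') hnorm with hu
  have hu_val : (u : ((Icc a b) × E →ᵇ E) →L[ℝ] ((Icc a b) × E →ᵇ E)) = 1 + L' := by
    rw [hu, Units.val_oneSub, sub_neg_eq_add]
  set J' : ((Icc a b) × E →ᵇ E) →L[ℝ] ((Icc a b) × E →ᵇ E) := ↑u⁻¹ with hJ'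
  have h1 : ∀ V, J' (V + L' V) = V := fun V => by
    have := congrArg (fun T : ((Icc a b) × E →ᵇ E) →L[ℝ] ((Icc a b) × E →ᵇ E) => T V) u.inv_mul
    simpa [hJ', hu_val] using this
  have h2 : ∀ V, J' V + L' (J' V) = V := fun V => by
    have := congrArg (fun T : ((Icc a b) × E →ᵇ E) →L[ℝ] ((Icc a b) × E →ᵇ E) => T V) u.mul_inv
    simpa [hJ', hu_val] using this
  refine ⟨Θ.symm.toContinuousLinearMap ∘L J' ∘L Θ.toContinuousLinearMap, fun W => ?_, fun W => ?_⟩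
  · -- `Θ⁻¹ J' Θ (W + L W) = W`: `Θ (W + L W) = Θ W + L' (Θ W)`
    have hconj : Θ (slabLin hab U W) = L' (Θ W) := by
      rw [hL', slabLinConj_apply, ← hΘ, ContinuousLinearEquiv.symm_apply_apply]
    simp only [ContinuousLinearMap.comp_apply, ContinuousLinearEquiv.coe_coe]
    rw [map_add, hconj, h1, ContinuousLinearEquiv.symm_apply_apply]
  · -- `Θ⁻¹ J' Θ W + L (Θ⁻¹ J' Θ W) = W`: apply `Θ` and use `h2`
    apply Θ.injective
    have hconj : ∀ V, Θ (slabLin hab U (Θ.symm V)) = L' V := fun V => by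
      rw [hL', slabLinConj_apply, ← hΘ]
    simp only [ContinuousLinearMap.comp_apply, ContinuousLinearEquiv.coe_coe, map_add,
      ContinuousLinearEquiv.apply_symm_apply, hconj, h2]

/-- **The solution operator of the sup-small perturbation equation on the slab and its strict
derivative.**  For a background slab field `U` there are radii `r, ρ > 0`, a bounded operator
`A = (1 + L_a[U])⁻¹ e^{(·-a)Δ}` from data to slab fields, and a map `sol` such that for data `g`
with `‖g‖ < r`, `w = sol g` is the unique slab field in the ball `‖w‖ ≤ ρ` solving
`w = e^{(·-a)Δ} g − L_a[U](w) − B_a(w, w)`; `sol 0 = 0`, `sol` is `2‖A‖`-Lipschitz, and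
`HasStrictFDerivAt sol A 0` — where `A h = e^{(·-a)Δ}h − L_a[U](A h)` is the solution operator
of the LINEARISED equation (`Literature.Analysis.Calculus.exists_solutionMap_hasStrictFDerivAt`
with `J = (1 + L_a[U])⁻¹`, `Q = B_a`). [cite: Henry1981, Thm 3.4.4] -/
theorem exists_slabSolutionMap (U : (Icc a b) × E →ᵇ E) :
    ∃ A : (E →ᵇ E) →L[ℝ] ((Icc a b) × E →ᵇ E),
      (∀ h, A h + slabLin hab U (A h) = slabHeat h) ∧
    ∃ r : ℝ, 0 < r ∧ ∃ ρ : ℝ, 0 < ρ ∧ ∃ sol : (E →ᵇ E) → ((Icc a b) × E →ᵇ E),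
      sol 0 = 0 ∧
      (∀ g, ‖g‖ < r → ‖sol g‖ ≤ ρ ∧
        sol g + slabLin hab U (sol g) + slabBilin hab (sol g) (sol g) = slabHeat g) ∧
      (∀ g w, ‖g‖ < r → ‖w‖ ≤ ρ →
        w + slabLin hab U w + slabBilin hab w w = slabHeat g → w = sol g) ∧
      (∀ g₁ g₂, ‖g₁‖ < r → ‖g₂‖ < r → ‖sol g₁ - sol g₂‖ ≤ 2 * ‖A‖ * ‖g₁ - g₂‖) ∧
      (∀ g, ‖g‖ < r → ‖sol g‖ ≤ 2 * ‖A‖ * ‖g‖) ∧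
      HasStrictFDerivAt sol A 0 ∧
      (∀ S : Submodule ℝ ((Icc a b) × E →ᵇ E), IsClosed (S : Set ((Icc a b) × E →ᵇ E)) →
        (∀ V, slabLin hab U V ∈ S) → ∀ g, ‖g‖ < r → slabHeat g ∈ S →
        (∀ w ∈ S, ‖w‖ ≤ ρ → slabBilin hab w w ∈ S) → sol g ∈ S) := by
  obtain ⟨J, hJ1, hJ2⟩ := exists_inverse_one_add_slabLin hab U
  set A : (E →ᵇ E) →L[ℝ] ((Icc a b) × E →ᵇ E) := J ∘L slabHeat with hA
  obtain ⟨r, hr, ρ, hρ, sol, hsol0, hsol, huniq, hLip, hbd, hderiv, hinv⟩ :=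
    Literature.Analysis.Calculus.exists_solutionMap_hasStrictFDerivAt_invariant A J (slabBilin hab)
  -- `J` preserves every submodule containing the range of `L`: `J V = V - L (J V)`
  have hJmem : ∀ S : Submodule ℝ ((Icc a b) × E →ᵇ E), (∀ V, slabLin hab U V ∈ S) →
      ∀ V ∈ S, J V ∈ S := fun S hLS V hV => by
    have h := hJ2 V
    have : J V = V - slabLin hab U (J V) := by rw [← h]; abel_nf; rw [h]; abel
    rw [eq_sub_of_add_eq (hJ2 V)]
    exact S.sub_mem hV (hLS _)
  refine ⟨A, fun h => by simpa [hA] using hJ2 (slabHeat h), r, hr, ρ, hρ, sol, hsol0,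
    fun g hg => ⟨(hsol g hg).1, ?_⟩, fun g w hg hw heq => ?_, hLip, hbd, hderiv,
    fun S hS hLS g hg hHg hQ => ?_⟩
  · -- from `sol g = A g - J (Q (sol g) (sol g))` to the unweighted equation
    have he := (hsol g hg).2
    have key : sol g = J (slabHeat g - slabBilin hab (sol g) (sol g)) := by
      rw [map_sub]; exact he
    have := hJ2 (slabHeat g - slabBilin hab (sol g) (sol g))
    rw [← key] at this
    rw [this, sub_add_cancel]
  · -- uniqueness: `w = A g - J (Q w w)` because `J (1 + L) = 1`
    refine huniq g w hg hw ?_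
    have h3 : w + slabLin hab U w = slabHeat g - slabBilin hab w w := by rw [← heq]; abel
    calc w = J (w + slabLin hab U w) := (hJ1 w).symm
      _ = J (slabHeat g - slabBilin hab w w) := by rw [h3]
      _ = A g - J (slabBilin hab w w) := by rw [map_sub, hA]; rfl
  · -- invariance of closed submodules containing the range of `L`
    refine hinv S hS S.zero_mem g hg fun w hw hwρ => ?_
    have : A g - J (slabBilin hab w w) = J (slabHeat g - slabBilin hab w w) := by
      rw [map_sub, hA]; rfl
    rw [this]
    exact hJmem S hLS _ (S.sub_mem hHg (hQ w hw hwρ))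

end Solve

end Literature.Analysis.FluidPDE

end
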